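import Summits.NavierStokesRegularity.NavierStokesRegularity.Theorems.OddMorawetzLocal.Negative.OddMorawetzLocalRefutationDefsIV
import Summits.NavierStokesRegularity.NavierStokesRegularity.Theorems.OddMorawetzLocal.Negative.OddMorawetzLocalB3Reduction
import Summits.NavierStokesRegularity.NavierStokesRegularity.Theorems.OddMorawetzOddMorawetzLocalDensCalculus
import Summits.NavierStokesRegularity.NavierStokesRegularity.Theorems.OddMorawetzOddMorawetzLocalCoeffSemantics
import Summits.NavierStokesRegularity.NavierStokesRegularity.Theorems.OddMorawetzOddMorawetzLocalIdxComplete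
import HarnessLib

/-!
# Crux `OddMorawetzLocal` (stmt-NavierStokesRegularity-1376), refutation — properties of the Morawetz pairing

Stub `pairing_props` of the refutation skeleton of the line `registered` (lead c1).  The certificate functional of
the crux is `Q v = -∫ Dm(Jv x)[J B(v,v) x] dx`; for the density `m = densV k τ` of a coefficient vector `τ : V k`
on the monomial basis `idx k` this is the Morawetz pairing
`morawetzPairing k v τ = -∫ lin (polyOfV k τ) (jetVal v x) (jetVal (B(v,v)) x) dx`
(`Theorems/OddMorawetzLocal/Negative/OddMorawetzLocalRefutationDefsIV.lean`).  This file proves, for a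
divergence-free Schwartz field `v`:

* `lin_polyOfV_jetVal` — the pointwise identity `lin (polyOfV k τ) (jetVal u x) (jetVal b x) = D(densV k τ)(Ju x)[Jb x]`
  (the derivative of a polynomial density is its linearisation, `fderiv_dens_apply`; the linearisation only sees
  the variables of the polynomial, `lin_congr`, which are basis monomials of jet order `≤ 3`,
  `canonical_of_mem_idx`, where `jetVal = coord ∘ J`, `jetVal_eq_coord`);
* `integrable_lin_polyOfV` — part (1): the integrand of the pairing is integrable (`integrable_fderiv_jets` for the
  smooth density `densV k τ`);
* `morawetzPairing_eq_fderiv_densV` — part (3): the pairing is the crux's Euler derivative of `densV k τ`;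
* `lin_polyOfV`, `morawetzPairing_add`, `morawetzPairing_smul`, `exists_clm_morawetzPairing` — part (2): the
  pairing is `Σ_i τ i · (-∫ prodDeriv mᵢ)`, hence linear in `τ`, hence a continuous linear functional on the
  finite-dimensional coefficient space `V k`;
* `lin_eq_sum_coeffOf`, `coeffOf_map_intCast`, `lin_polyOfV_vecOf` — part (4): for an integer polynomial `p` whose
  monomials are basis monomials, the linearisation of `polyOfV k (vecOf k p)` is that of `p` itself (regrouping the
  terms of `p` by the duplicate-free basis, `nodup_idx`, exactly as `evalA_eq_sum_coeffOf` does for values).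

They are assembled in `pairing_props` (the registered signature).  Mathlib (`integral_add`, `integral_const_mul`,
`LinearMap.toContinuousLinearMap`) on top of the landed `fderiv_dens_apply` / `contDiff_dens` / `jetVal_eq_coord`
(`…DensCalculus`), `integrable_fderiv_jets` (`…B3Reduction`), `canonical_of_mem_idx` / `nodup_idx`
(`…IdxComplete`), `coeffOf_cons` (`…CoeffSemantics`); no definitions, no named facts.
-/

noncomputable section

open MeasureTheory

set_option linter.dupNamespace false
set_option autoImplicit false

namespace Summit.NavierStokesRegularity.NavierStokesRegularity.Theorems.OddMorawetz

/-! ### The linearisation only depends on the variables of the polynomial -/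

/-- `prodDeriv m ζ η` only depends on the values of `ζ`, `η` on the variables of `m`. -/
theorem prodDeriv_congr {ζ ζ' η η' : JVar → ℝ} :
    ∀ m : List JVar, (∀ w ∈ m, ζ w = ζ' w) → (∀ w ∈ m, η w = η' w) →
      JPoly.prodDeriv m ζ η = JPoly.prodDeriv m ζ' η'
  | [], _, _ => by simp [JPoly.prodDeriv]
  | w :: ws, hζ, hη => by
    have hζ' : ∀ u ∈ ws, ζ u = ζ' u := fun u hu => hζ u (List.mem_cons_of_mem _ hu)
    have hη' : ∀ u ∈ ws, η u = η' u := fun u hu => hη u (List.mem_cons_of_mem _ hu)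
    simp only [JPoly.prodDeriv]
    rw [hη w List.mem_cons_self, hζ w List.mem_cons_self, prodDeriv_congr ws hζ' hη',
      List.map_congr_left hζ']

/-- `lin p ζ η` only depends on the values of `ζ`, `η` on the variables occurring in `p`. -/
theorem lin_congr {ζ ζ' η η' : JVar → ℝ} (p : JPoly ℝ) (hζ : ∀ t ∈ p, ∀ w ∈ t.2, ζ w = ζ' w)
    (hη : ∀ t ∈ p, ∀ w ∈ t.2, η w = η' w) : JPoly.lin p ζ η = JPoly.lin p ζ' η' := by
  unfold JPoly.lin
  rw [List.map_congr_left (fun t ht => by rw [prodDeriv_congr t.2 (hζ t ht) (hη t ht)])]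

/-! ### The polynomial of a coefficient vector -/

/-- Every monomial of `polyOfV k τ` is a basis monomial of weight `k`. -/
theorem mem_idx_of_mem_polyOfV (k : ℕ) (τ : V k) (t : ℝ × List JVar) (ht : t ∈ polyOfV k τ) : t.2 ∈ idx k := by
  simp only [polyOfV, List.mem_map, List.mem_finRange, true_and] at ht
  obtain ⟨i, rfl⟩ := ht
  exact List.get_mem (idx k) i

/-- Variables of basis monomials have jet order `≤ 3`. -/
theorem length_le_three_of_mem_idx {k : ℕ} {m : List JVar} (hm : m ∈ idx k) (w : JVar) (hw : w ∈ m) :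
    w.2.length ≤ 3 :=
  ((canonical_of_mem_idx hm).2.2.1 w hw).2

/-- **The linearisation of the polynomial of a coefficient vector**: `Σ_i τ i · prodDeriv mᵢ ζ η`. -/
theorem lin_polyOfV (k : ℕ) (τ : V k) (ζ η : JVar → ℝ) :
    JPoly.lin (polyOfV k τ) ζ η = ∑ i, τ i * JPoly.prodDeriv ((idx k).get i) ζ η := by
  rw [Fin.sum_univ_def]
  simp only [JPoly.lin, polyOfV, List.map_map, Function.comp_def]

/-- Additivity of `lin ∘ polyOfV` in the coefficient vector. -/
theorem lin_polyOfV_add (k : ℕ) (τ σ : V k) (ζ η : JVar → ℝ) :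
    JPoly.lin (polyOfV k (τ + σ)) ζ η = JPoly.lin (polyOfV k τ) ζ η + JPoly.lin (polyOfV k σ) ζ η := by
  simp only [lin_polyOfV, Pi.add_apply, add_mul, Finset.sum_add_distrib]

/-- Homogeneity of `lin ∘ polyOfV` in the coefficient vector. -/
theorem lin_polyOfV_smul (k : ℕ) (c : ℝ) (τ : V k) (ζ η : JVar → ℝ) :
    JPoly.lin (polyOfV k (c • τ)) ζ η = c * JPoly.lin (polyOfV k τ) ζ η := by
  simp only [lin_polyOfV, Pi.smul_apply, smul_eq_mul, mul_assoc, Finset.mul_sum]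

/-! ### The pointwise identity: the pairing integrand is the Euler-derivative integrand of `densV` -/

/-- **Pointwise identity.** For every coefficient vector `τ`, fields `u`, `b` and point `x`,
`lin (polyOfV k τ) (jetVal u x) (jetVal b x) = D(densV k τ)(Ju x)[Jb x]` with `Ju x = (u x, Du x, D²u x, D³u x)`. -/
theorem lin_polyOfV_jetVal (k : ℕ) (τ : V k) (u b : EuclideanSpace ℝ (Fin 3) → EuclideanSpace ℝ (Fin 3))
    (x : EuclideanSpace ℝ (Fin 3)) :
    JPoly.lin (polyOfV k τ) (jetVal u x) (jetVal b x) =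
      fderiv ℝ (densV k τ) ((u x, iteratedFDeriv ℝ 1 u x, iteratedFDeriv ℝ 2 u x, iteratedFDeriv ℝ 3 u x) : Jet3)
        ((b x, iteratedFDeriv ℝ 1 b x, iteratedFDeriv ℝ 2 b x, iteratedFDeriv ℝ 3 b x) : Jet3) := by
  rw [show densV k τ = JPoly.dens (polyOfV k τ) from rfl, fderiv_dens_apply]
  exact lin_congr (polyOfV k τ)
    (fun t ht w hw => jetVal_eq_coord u x w (length_le_three_of_mem_idx (mem_idx_of_mem_polyOfV k τ t ht) w hw))
    (fun t ht w hw => jetVal_eq_coord b x w (length_le_three_of_mem_idx (mem_idx_of_mem_polyOfV k τ t ht) w hw))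

/-! ### Part (1): integrability -/

/-- The density of a coefficient vector is smooth. -/
theorem contDiff_densV (k : ℕ) (τ : V k) : ContDiff ℝ (⊤ : ℕ∞) (densV k τ) :=
  contDiff_dens (polyOfV k τ)

/-- **Part (1).** For a divergence-free Schwartz field `v`, the pairing integrand
`x ↦ lin (polyOfV k τ) (jetVal v x) (jetVal (B(v,v)) x)` is integrable. -/
theorem integrable_lin_polyOfV (k : ℕ) (v : EuclideanSpace ℝ (Fin 3) → EuclideanSpace ℝ (Fin 3))
    (hv : Literature.Analysis.FluidPDE.IsSchwartzField v) (hd : Literature.Analysis.FluidPDE.VectorCalculus.IsDivFree v)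
    (τ : V k) :
    Integrable (fun x => JPoly.lin (polyOfV k τ) (jetVal v x)
      (jetVal (Literature.Analysis.FluidPDE.eulerBilinear v v) x)) := by
  simp only [lin_polyOfV_jetVal]
  exact integrable_fderiv_jets ((contDiff_densV k τ).of_le (by simp)) hv hd

/-! ### Part (3): the pairing is the Euler derivative of `densV` -/

/-- **Part (3).** `morawetzPairing k v τ = -∫ D(densV k τ)(Jv x)[J B(v,v) x] dx`. -/
theorem morawetzPairing_eq_fderiv_densV (k : ℕ) (v : EuclideanSpace ℝ (Fin 3) → EuclideanSpace ℝ (Fin 3))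
    (τ : V k) :
    morawetzPairing k v τ =
      -∫ x, fderiv ℝ (densV k τ)
        ((v x, iteratedFDeriv ℝ 1 v x, iteratedFDeriv ℝ 2 v x, iteratedFDeriv ℝ 3 v x) : Jet3)
        ((Literature.Analysis.FluidPDE.eulerBilinear v v x,
          iteratedFDeriv ℝ 1 (Literature.Analysis.FluidPDE.eulerBilinear v v) x,
          iteratedFDeriv ℝ 2 (Literature.Analysis.FluidPDE.eulerBilinear v v) x,
          iteratedFDeriv ℝ 3 (Literature.Analysis.FluidPDE.eulerBilinear v v) x) : Jet3) := by
  unfold morawetzPairing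
  simp only [lin_polyOfV_jetVal]

/-! ### Part (2): linearity in the coefficient vector -/

/-- Additivity of the pairing in `τ`. -/
theorem morawetzPairing_add (k : ℕ) (v : EuclideanSpace ℝ (Fin 3) → EuclideanSpace ℝ (Fin 3))
    (hv : Literature.Analysis.FluidPDE.IsSchwartzField v) (hd : Literature.Analysis.FluidPDE.VectorCalculus.IsDivFree v)
    (τ σ : V k) : morawetzPairing k v (τ + σ) = morawetzPairing k v τ + morawetzPairing k v σ := by
  unfold morawetzPairing
  simp only [lin_polyOfV_add]
  rw [integral_add (integrable_lin_polyOfV k v hv hd τ) (integrable_lin_polyOfV k v hv hd σ), neg_add]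

/-- Homogeneity of the pairing in `τ`. -/
theorem morawetzPairing_smul (k : ℕ) (v : EuclideanSpace ℝ (Fin 3) → EuclideanSpace ℝ (Fin 3)) (c : ℝ)
    (τ : V k) : morawetzPairing k v (c • τ) = c * morawetzPairing k v τ := by
  unfold morawetzPairing
  simp only [lin_polyOfV_smul]
  rw [integral_const_mul, mul_neg]

/-- **Part (2).** `τ ↦ morawetzPairing k v τ` is a continuous linear functional on `V k`. -/
theorem exists_clm_morawetzPairing (k : ℕ) (v : EuclideanSpace ℝ (Fin 3) → EuclideanSpace ℝ (Fin 3))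
    (hv : Literature.Analysis.FluidPDE.IsSchwartzField v) (hd : Literature.Analysis.FluidPDE.VectorCalculus.IsDivFree v) :
    ∃ Λ : V k →L[ℝ] ℝ, ∀ τ : V k, Λ τ = morawetzPairing k v τ :=
  ⟨LinearMap.toContinuousLinearMap
      { toFun := morawetzPairing k v
        map_add' := morawetzPairing_add k v hv hd
        map_smul' := fun c τ => by rw [morawetzPairing_smul, RingHom.id_apply, smul_eq_mul] },
    fun _ => rfl⟩

/-! ### Part (4): integer polynomials on the basis -/

/-- `lin` of a cons with an explicit head pair. -/
theorem lin_cons_pair (c : ℝ) (m : List JVar) (p : JPoly ℝ) (ζ η : JVar → ℝ) :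
    JPoly.lin ((c, m) :: p) ζ η = c * JPoly.prodDeriv m ζ η + JPoly.lin p ζ η := by
  simp [JPoly.lin]

/-- **Regrouping the linearisation by the basis.** A polynomial all of whose monomials are basis monomials of
weight `k` has `lin q ζ η = Σ_i coeffOf q mᵢ · prodDeriv mᵢ ζ η` (the basis `idx k` is duplicate-free). -/
theorem lin_eq_sum_coeffOf (k : ℕ) (ζ η : JVar → ℝ) :
    ∀ q : JPoly ℝ, (∀ t ∈ q, t.2 ∈ idx k) →
      JPoly.lin q ζ η = ∑ i, JPoly.coeffOf q ((idx k).get i) * JPoly.prodDeriv ((idx k).get i) ζ η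
  | [], _ => by simp [JPoly.lin, JPoly.coeffOf]
  | (c, m) :: q, hq => by
    have hm : m ∈ idx k := hq (c, m) List.mem_cons_self
    obtain ⟨i₀, hi₀⟩ := List.get_of_mem hm
    have hinj : Function.Injective (idx k).get := List.nodup_iff_injective_get.1 (nodup_idx k)
    rw [lin_cons_pair, lin_eq_sum_coeffOf k ζ η q (fun t ht => hq t (List.mem_cons_of_mem _ ht))]
    simp only [coeffOf_cons, add_mul, Finset.sum_add_distrib]
    congr 1
    rw [Finset.sum_eq_single i₀]
    · rw [if_pos hi₀, hi₀]
    · intro i _ hi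
      rw [if_neg (fun h => hi (hinj (h.trans hi₀.symm))), zero_mul]
    · intro h
      exact absurd (Finset.mem_univ i₀) h

/-- Casting the coefficients `ℤ → ℝ` commutes with `coeffOf`. -/
theorem coeffOf_map_intCast (p : JPoly ℤ) (m : List JVar) :
    JPoly.coeffOf (p.map fun t => ((t.1 : ℝ), t.2)) m = ((JPoly.coeffOf p m : ℤ) : ℝ) := by
  induction p with
  | nil => simp [JPoly.coeffOf]
  | cons t p ih =>
    obtain ⟨c, m'⟩ := t
    simp only [List.map_cons, coeffOf_cons, ih, Int.cast_add, Int.cast_ite, Int.cast_zero]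

/-- The monomials of the cast of an integer polynomial are those of the polynomial. -/
theorem mem_idx_of_mem_map_intCast {k : ℕ} (p : JPoly ℤ) (hp : ∀ t ∈ p, t.2 ∈ idx k) :
    ∀ t ∈ (p.map fun t => ((t.1 : ℝ), t.2)), t.2 ∈ idx k := by
  intro t ht
  obtain ⟨s, hs, rfl⟩ := List.mem_map.1 ht
  exact hp s hs

/-- **Part (4).** For an integer polynomial `p` whose monomials are basis monomials of weight `k`, the
linearisation of the polynomial of its coefficient vector `vecOf k p` is the linearisation of (the cast of) `p`. -/
theorem lin_polyOfV_vecOf (k : ℕ) (p : JPoly ℤ) (hp : ∀ t ∈ p, t.2 ∈ idx k) (ζ η : JVar → ℝ) :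
    JPoly.lin (polyOfV k (fun i => ((vecOf k p i : ℤ) : ℝ))) ζ η =
      JPoly.lin (p.map fun t => ((t.1 : ℝ), t.2)) ζ η := by
  rw [lin_polyOfV, lin_eq_sum_coeffOf k ζ η _ (mem_idx_of_mem_map_intCast p hp)]
  refine Finset.sum_congr rfl fun i _ => ?_
  rw [coeffOf_map_intCast]
  rfl

/-! ### The registered stub -/

/-- **Stub `pairing_props`** (refutation of crux `OddMorawetzLocal`).  For a divergence-free Schwartz field `v`
and a weight `k`: (1) the Morawetz pairing integrand `lin (polyOfV k τ) (jetVal v ·) (jetVal (B(v,v)) ·)` of every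
coefficient vector `τ` is integrable; (2) `τ ↦ morawetzPairing k v τ` is a continuous linear functional on `V k`;
(3) the pairing is the crux's Euler derivative `-∫ D(densV k τ)(Jv)[J B(v,v)]`; (4) for an integer polynomial `p`
on the basis (distinct basis monomials), `lin (polyOfV k (vecOf k p))` agrees pointwise with `lin` of `p`. -/
theorem pairing_props (k : ℕ) (v : EuclideanSpace ℝ (Fin 3) → EuclideanSpace ℝ (Fin 3))
    (hv : Literature.Analysis.FluidPDE.IsSchwartzField v) (hd : Literature.Analysis.FluidPDE.VectorCalculus.IsDivFree v) :
    (∀ τ : V k, Integrable (fun x => JPoly.lin (polyOfV k τ) (jetVal v x)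
        (jetVal (Literature.Analysis.FluidPDE.eulerBilinear v v) x))) ∧
    (∃ Λ : V k →L[ℝ] ℝ, ∀ τ : V k, Λ τ = morawetzPairing k v τ) ∧
    (∀ τ : V k, morawetzPairing k v τ =
      -∫ x, fderiv ℝ (densV k τ)
        ((v x, iteratedFDeriv ℝ 1 v x, iteratedFDeriv ℝ 2 v x, iteratedFDeriv ℝ 3 v x) : Jet3)
        ((Literature.Analysis.FluidPDE.eulerBilinear v v x,
          iteratedFDeriv ℝ 1 (Literature.Analysis.FluidPDE.eulerBilinear v v) x,
          iteratedFDeriv ℝ 2 (Literature.Analysis.FluidPDE.eulerBilinear v v) x,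
          iteratedFDeriv ℝ 3 (Literature.Analysis.FluidPDE.eulerBilinear v v) x) : Jet3)) ∧
    (∀ (p : JPoly ℤ), (∀ t ∈ p, t.2 ∈ idx k) → (p.Pairwise fun s t => s.2 ≠ t.2) →
      ∀ x, JPoly.lin (polyOfV k (fun i => ((vecOf k p i : ℤ) : ℝ))) (jetVal v x)
          (jetVal (Literature.Analysis.FluidPDE.eulerBilinear v v) x) =
        JPoly.lin (p.map fun t => ((t.1 : ℝ), t.2)) (jetVal v x)
          (jetVal (Literature.Analysis.FluidPDE.eulerBilinear v v) x)) :=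
  ⟨integrable_lin_polyOfV k v hv hd, exists_clm_morawetzPairing k v hv hd, morawetzPairing_eq_fderiv_densV k v,
    fun p hp _ x =>
      lin_polyOfV_vecOf k p hp (jetVal v x) (jetVal (Literature.Analysis.FluidPDE.eulerBilinear v v) x)⟩

end Summit.NavierStokesRegularity.NavierStokesRegularity.Theorems.OddMorawetz

end
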